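import Summits.CriticalPhenomena.Ising3DConformalLimit.Theorems.MoebiusLimitExists.Negative.ScaleFree
import Summits.CriticalPhenomena.Ising3DConformalLimit.Theorems.MoebiusLimitExists.Negative.EtaExists
import Literature.Barriers.CriticalPhenomena.ScaleCovarianceNotMoebius

/-!
# `MoebiusLimit` (item stmt-CriticalPhenomena-1344): the clauses `0 < Δ` and `IsScaleCovariant Δ S` are REDUNDANT

Structural knowledge about the crux `…Theses.EnergyNotSigmaSquared.MoebiusLimit`
(= `PerfectScreening.MoebiusLimitExists`), standing crux disprover (D-0016); THEOREM-ONLY.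
Building on `Negative/ScaleFree.lean` (dilation covariance with some `Δ' ≥ 0` is automatic on
`NonCoincident` for any non-degenerate pointwise limit of the critical correlators on `ℤ³`):

* `exists_scaleCovariant_normalised` — the normalised limit (zero off `NonCoincident`) is scale
  covariant with `Δ' ∈ [1/2, 1]` (tree `scalingDimension_mem_Icc_holds`);
* `delta_eq_of_inversion_of_scale` — for a Euclidean-invariant non-degenerate family, inversion
  covariance with `Δ` and scale covariance with `Δ'` force `Δ = Δ'` (pair `(e₀, 2e₀)`);
* `moebiusLimit_iff_without_scale` — **the crux is equivalent to**: `∃ ρ Δ S`, `ρ > 0` on `(0,1]`,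
  pointwise limit, non-degenerate, Euclidean invariant, inversion covariant with `Δ` — no `0 < Δ`,
  no dilation clause; likewise `critIsing3DConformalLimit_iff_without_scale` for the conjunct and
  `critIsing3DEuclideanLimit_iff_without_scale`: crit-ising.S03 is "a non-degenerate Euclidean-
  invariant pointwise limit exists" — `Δ` and dilations are outputs (Kadanoff's scaling postulate
  is a consequence of existence + non-degeneracy, via Messager–Miracle-Solé and Cauchy's equation).
-/

noncomputable section

namespace Summit.CriticalPhenomena.Ising3DConformalLimit.MoebiusLimitExistsNegative

open Literature.Probability.LatticeModels Filter Set
open scoped Topology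

variable {ρ : ℝ → ℝ} {S : CorrFamily 3}


open Literature.Barriers.CriticalPhenomena.ScaleNotMoebius EuclideanGeometry Classical

/-- The normalised family (zero off `NonCoincident`) has the same pointwise limit. [folklore] -/
theorem normalised_hasLimit (hlim : HasPointwiseScalingLimit (criticalCorr 3) ρ S) :
    HasPointwiseScalingLimit (criticalCorr 3) ρ
      (fun n x => if x ∈ NonCoincident 3 n then S n x else 0) :=
  fun n => (hlim n).congr_right fun x hx => by simp only [if_pos hx]

/-- … and the same (non-degenerate) two-point function on `NonCoincident`. [folklore] -/
theorem normalised_nondeg (hnd : IsNondegenerateTwoPoint S) :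
    IsNondegenerateTwoPoint (fun n x => if x ∈ NonCoincident 3 n then S n x else 0) :=
  fun x hx => by simp only [if_pos hx]; exact hnd x hx

/-- Normalisation preserves translation invariance. [folklore] -/
theorem normalised_translation (h : IsTranslationInvariant S) :
    IsTranslationInvariant (fun n x => if x ∈ NonCoincident 3 n then S n x else 0) := by
  intro n v x
  have hiff : (fun i => x i + v) ∈ NonCoincident 3 n ↔ x ∈ NonCoincident 3 n := by
    rw [mem_nonCoincident, mem_nonCoincident]
    exact (add_left_injective v).of_comp_iff x
  by_cases hx : x ∈ NonCoincident 3 n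
  · simp only [if_pos (hiff.2 hx), if_pos hx, h n v x]
  · simp only [if_neg (mt hiff.1 hx), if_neg hx]

/-- Normalisation preserves rotation invariance. [folklore] -/
theorem normalised_rotation (h : IsRotationInvariant S) :
    IsRotationInvariant (fun n x => if x ∈ NonCoincident 3 n then S n x else 0) := by
  intro n R x
  have hiff : (fun i => R (x i)) ∈ NonCoincident 3 n ↔ x ∈ NonCoincident 3 n := by
    rw [mem_nonCoincident, mem_nonCoincident]
    exact R.injective.of_comp_iff x
  by_cases hx : x ∈ NonCoincident 3 n
  · simp only [if_pos (hiff.2 hx), if_pos hx, h n R x]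
  · simp only [if_neg (mt hiff.1 hx), if_neg hx]

/-- Normalisation preserves inversion covariance. [folklore] -/
theorem normalised_inversion {Δ : ℝ} (h : IsInversionCovariant Δ S) :
    IsInversionCovariant Δ (fun n x => if x ∈ NonCoincident 3 n then S n x else 0) := by
  intro n x hx0
  have hiff : (fun i => inversion (0 : EuclideanSpace ℝ (Fin 3)) 1 (x i)) ∈ NonCoincident 3 n ↔
      x ∈ NonCoincident 3 n := by
    rw [mem_nonCoincident, mem_nonCoincident]
    exact (inversion_injective _ one_ne_zero).of_comp_iff x
  by_cases hx : x ∈ NonCoincident 3 n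
  · simp only [if_pos (hiff.2 hx), if_pos hx, h n x hx0]
  · simp only [if_neg (mt hiff.1 hx), if_neg hx, mul_zero]

/-- Normalisation preserves scale covariance. [folklore] -/
theorem normalised_scale {Δ : ℝ} (h : IsScaleCovariant Δ S) :
    IsScaleCovariant Δ (fun n x => if x ∈ NonCoincident 3 n then S n x else 0) := by
  intro n c hc x
  by_cases hx : x ∈ NonCoincident 3 n
  · simp only [if_pos ((smul_mem_nonCoincident_iff hc.ne' x).2 hx), if_pos hx, h n c hc x]
  · simp only [if_neg (mt (smul_mem_nonCoincident_iff hc.ne' x).1 hx), if_neg hx, mul_zero]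

/-- The connected four-point function on `NonCoincident` is unchanged by normalisation. [folklore] -/
theorem hasNontrivialU4_normalised_iff :
    HasNontrivialU4 (fun n x => if x ∈ NonCoincident 3 n then S n x else 0) ↔ HasNontrivialU4 S := by
  have key : ∀ x ∈ NonCoincident 3 4,
      limitConnectedFour (fun n x => if x ∈ NonCoincident 3 n then S n x else 0) x =
        limitConnectedFour S x := by
    intro x hx
    have hinj : Function.Injective x := hx
    have hp : ∀ i j : Fin 4, i ≠ j → (![x i, x j] : Fin 2 → EuclideanSpace ℝ (Fin 3)) ∈ NonCoincident 3 2 :=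
      fun i j hij => pair_mem_nonCoincident (hinj.ne hij)
    simp only [limitConnectedFour, if_pos hx, if_pos (hp 0 1 (by decide)), if_pos (hp 2 3 (by decide)),
      if_pos (hp 0 2 (by decide)), if_pos (hp 1 3 (by decide)), if_pos (hp 0 3 (by decide)),
      if_pos (hp 1 2 (by decide))]
  constructor
  · rintro ⟨x, hx, h⟩; exact ⟨x, hx, by rwa [key x hx] at h⟩
  · rintro ⟨x, hx, h⟩; exact ⟨x, hx, by rwa [key x hx]⟩

/-- **Scale covariance of the normalised limit, with `Δ' ∈ [1/2, 1]`**: for ANY non-degenerate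
pointwise limit of the critical correlators on `ℤ³`. [folklore] -/
theorem exists_scaleCovariant_normalised (hρ : ∀ δ ∈ Set.Ioc (0:ℝ) 1, 0 < ρ δ)
    (hlim : HasPointwiseScalingLimit (criticalCorr 3) ρ S) (hnd : IsNondegenerateTwoPoint S) :
    ∃ Δ' : ℝ, Δ' ∈ Set.Icc (1 / 2 : ℝ) 1 ∧
      IsScaleCovariant Δ' (fun n x => if x ∈ NonCoincident 3 n then S n x else 0) := by
  obtain ⟨Δ', -, hsc⟩ := exists_scaleCovariant_on_nonCoincident hρ hlim hnd
  have hsc' : IsScaleCovariant Δ' (fun n x => if x ∈ NonCoincident 3 n then S n x else 0) := by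
    intro n c hc x
    by_cases hx : x ∈ NonCoincident 3 n
    · simp only [if_pos ((smul_mem_nonCoincident_iff hc.ne' x).2 hx), if_pos hx, hsc n c hc x hx]
    · simp only [if_neg (mt (smul_mem_nonCoincident_iff hc.ne' x).1 hx), if_neg hx, mul_zero]
  exact ⟨Δ', scalingDimension_mem_Icc_holds ρ Δ' _ (normalised_hasLimit hlim) hsc'
    (normalised_nondeg hnd) hρ, hsc'⟩

/-- **The inversion dimension is the scale dimension**: if a family with non-degenerate two-point
function is translation and rotation invariant, scale covariant with `Δ'` and inversion covariant
with `Δ`, then `Δ = Δ'` (evaluate both covariances on the pair `(e₀, 2e₀)`).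
[cite: FrancescoMathieuSenechal1997, §4.3.1 eq. (4.55)] -/
theorem delta_eq_of_inversion_of_scale {Δ Δ' : ℝ} {S : CorrFamily 3} (hnd : IsNondegenerateTwoPoint S)
    (htr : IsTranslationInvariant S) (hrot : IsRotationInvariant S) (hsc : IsScaleCovariant Δ' S)
    (hinv : IsInversionCovariant Δ S) : Δ = Δ' := by
  -- the pair `(e₀, 2e₀)` and its inversion `(e₀, e₀/2)`
  have hx0 : ∀ i, (![axisPt 1, axisPt 2] : Fin 2 → EuclideanSpace ℝ (Fin 3)) i ≠ 0 := by
    intro i; fin_cases i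
    · exact axisPt_ne_zero one_ne_zero
    · exact axisPt_ne_zero two_ne_zero
  have h1 := hinv 2 ![axisPt 1, axisPt 2] hx0
  have hcfg : (fun i => inversion (0 : EuclideanSpace ℝ (Fin 3)) 1
      ((![axisPt 1, axisPt 2] : Fin 2 → EuclideanSpace ℝ (Fin 3)) i)) = ![axisPt 1, axisPt 2⁻¹] := by
    funext i; fin_cases i
    · simp [inversion_axisPt one_ne_zero]
    · simp [inversion_axisPt two_ne_zero]
  have hprod : (∏ i, ‖(![axisPt 1, axisPt 2] : Fin 2 → EuclideanSpace ℝ (Fin 3)) i‖ ^ (2 * Δ)) =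
      (2:ℝ) ^ (2 * Δ) := by
    rw [Fin.prod_univ_two]
    simp [norm_axisPt]
  rw [hcfg, hprod] at h1
  -- translate both pairs to the origin
  have ht1 := htr 2 (-axisPt 1) ![axisPt 1, axisPt 2⁻¹]
  have hc1 : (fun i => (![axisPt 1, axisPt 2⁻¹] : Fin 2 → EuclideanSpace ℝ (Fin 3)) i + -axisPt 1) =
      ![0, axisPt (2⁻¹ - 1)] := by
    funext i; fin_cases i
    · simp
    · simp only [Fin.mk_one, Matrix.cons_val_one, Matrix.cons_val_fin_one]
      rw [← sub_eq_add_neg, axisPt_sub_axisPt]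
      rfl
  rw [hc1] at ht1
  have ht2 := htr 2 (-axisPt 1) ![axisPt 1, axisPt 2]
  have hc2 : (fun i => (![axisPt 1, axisPt 2] : Fin 2 → EuclideanSpace ℝ (Fin 3)) i + -axisPt 1) =
      ![0, axisPt (2 - 1)] := by
    funext i; fin_cases i
    · simp
    · simp only [Fin.mk_one, Matrix.cons_val_one, Matrix.cons_val_fin_one]
      rw [← sub_eq_add_neg, axisPt_sub_axisPt]
      rfl
  rw [hc2] at ht2
  rw [← ht1, ← ht2] at h1
  -- the radial two-point function
  have hA : 0 < S 2 ![0, EuclideanSpace.single 0 1] :=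
    hnd _ (zero_unitVec_mem_nonCoincident one_ne_zero)
  have hr1 := two_point_radial hrot hsc (axisPt_ne_zero (by norm_num : (2:ℝ)⁻¹ - 1 ≠ 0))
  have hr2 := two_point_radial hrot hsc (axisPt_ne_zero (by norm_num : (2:ℝ) - 1 ≠ 0))
  rw [norm_axisPt, show |(2:ℝ)⁻¹ - 1| = 2⁻¹ by norm_num] at hr1
  rw [norm_axisPt, show |(2:ℝ) - 1| = 1 by norm_num, Real.one_rpow, one_mul] at hr2
  rw [hr1, hr2] at h1
  -- `2^{2Δ'} A = 2^{2Δ} A`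
  have hpow : ((2:ℝ)⁻¹) ^ (-(2:ℝ) * Δ') = (2:ℝ) ^ (2 * Δ') := by
    rw [Real.inv_rpow (by norm_num), ← Real.rpow_neg (by norm_num)]; ring_nf
  rw [hpow] at h1
  have h2 : (2:ℝ) ^ (2 * Δ') = (2:ℝ) ^ (2 * Δ) := by
    have := mul_right_cancel₀ hA.ne' h1
    exact this
  have hle1 := (Real.rpow_le_rpow_left_iff one_lt_two).1 h2.le
  have hle2 := (Real.rpow_le_rpow_left_iff one_lt_two).1 h2.ge
  linarith

/-- **The crux needs no dilation clause**: `MoebiusLimit` is equivalent to the existence of a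
non-degenerate pointwise limit which is Euclidean invariant and inversion covariant for SOME `Δ`
(the clauses `0 < Δ` and `IsScaleCovariant Δ S` are then automatic, with the same `Δ`).
[folklore] -/
theorem moebiusLimit_iff_without_scale :
    Summit.CriticalPhenomena.Ising3DConformalLimit.Theses.EnergyNotSigmaSquared.MoebiusLimit ↔
      ∃ (ρ : ℝ → ℝ) (Δ : ℝ) (S : CorrFamily 3), (∀ δ ∈ Set.Ioc (0:ℝ) 1, 0 < ρ δ) ∧
        HasPointwiseScalingLimit (criticalCorr 3) ρ S ∧ IsNondegenerateTwoPoint S ∧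
          IsEuclideanInvariant S ∧ IsInversionCovariant Δ S := by
  constructor
  · rintro ⟨ρ, Δ, S, h1, -, h3, h4, h5⟩
    exact ⟨ρ, Δ, S, h1, h3, h4, h5.1, h5.2.2⟩
  · rintro ⟨ρ, Δ, S, hρ, hlim, hnd, hE, hinv⟩
    obtain ⟨Δ', hwin, hsc'⟩ := exists_scaleCovariant_normalised hρ hlim hnd
    have hlim' := normalised_hasLimit hlim
    have hnd' := normalised_nondeg hnd
    have htr' := normalised_translation hE.1
    have hrot' := normalised_rotation hE.2
    have hinv' := normalised_inversion hinv
    have hΔ : Δ = Δ' := delta_eq_of_inversion_of_scale hnd' htr' hrot' hsc' hinv'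
    rw [← hΔ] at hsc' hwin
    exact ⟨ρ, Δ, _, hρ, by linarith [hwin.1], hlim', hnd', ⟨htr', hrot'⟩, hsc', hinv'⟩

/-- **The summit conjunct needs no dilation clause either.** [folklore] -/
theorem critIsing3DConformalLimit_iff_without_scale :
    CritIsing3DConformalLimit ↔
      ∃ (ρ : ℝ → ℝ) (Δ : ℝ) (S : CorrFamily 3), (∀ δ ∈ Set.Ioc (0:ℝ) 1, 0 < ρ δ) ∧
        HasPointwiseScalingLimit (criticalCorr 3) ρ S ∧ IsNondegenerateTwoPoint S ∧
          IsEuclideanInvariant S ∧ IsInversionCovariant Δ S ∧ HasNontrivialU4 S := by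
  constructor
  · rintro ⟨ρ, Δ, S, h1, -, h3, h4, h5, h6⟩
    exact ⟨ρ, Δ, S, h1, h3, h4, h5.1, h5.2.2, h6⟩
  · rintro ⟨ρ, Δ, S, hρ, hlim, hnd, hE, hinv, hU⟩
    obtain ⟨Δ', hwin, hsc'⟩ := exists_scaleCovariant_normalised hρ hlim hnd
    have hlim' := normalised_hasLimit hlim
    have hnd' := normalised_nondeg hnd
    have htr' := normalised_translation hE.1
    have hrot' := normalised_rotation hE.2
    have hinv' := normalised_inversion hinv
    have hΔ : Δ = Δ' := delta_eq_of_inversion_of_scale hnd' htr' hrot' hsc' hinv'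
    rw [← hΔ] at hsc' hwin
    exact ⟨ρ, Δ, _, hρ, by linarith [hwin.1], hlim', hnd', ⟨⟨htr', hrot'⟩, hsc', hinv'⟩,
      hasNontrivialU4_normalised_iff.2 hU⟩

/-- **The Euclidean-limit conjecture (crit-ising.S03) needs neither `Δ` nor dilations**:
`CritIsing3DEuclideanLimit` is equivalent to the existence of a non-degenerate pointwise limit of
the critical correlators that is Euclidean invariant. [folklore] -/
theorem critIsing3DEuclideanLimit_iff_without_scale :
    CritIsing3DEuclideanLimit ↔
      ∃ (ρ : ℝ → ℝ) (S : CorrFamily 3), (∀ δ ∈ Set.Ioc (0:ℝ) 1, 0 < ρ δ) ∧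
        HasPointwiseScalingLimit (criticalCorr 3) ρ S ∧ IsNondegenerateTwoPoint S ∧
          IsEuclideanInvariant S := by
  constructor
  · rintro ⟨ρ, Δ, S, h1, -, h3, h4, h5, -⟩
    exact ⟨ρ, S, h1, h3, h4, h5⟩
  · rintro ⟨ρ, S, hρ, hlim, hnd, hE⟩
    obtain ⟨Δ', hwin, hsc'⟩ := exists_scaleCovariant_normalised hρ hlim hnd
    exact ⟨ρ, Δ', _, hρ, by linarith [hwin.1], normalised_hasLimit hlim, normalised_nondeg hnd,
      ⟨normalised_translation hE.1, normalised_rotation hE.2⟩, hsc'⟩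

/-- **Existence + non-degeneracy alone already give a scale-covariant limit with `Δ' ∈ [1/2,1]`**
(no symmetry input at all). [folklore] -/
theorem exists_scaleCovariant_limit_of_limit (hρ : ∀ δ ∈ Set.Ioc (0:ℝ) 1, 0 < ρ δ)
    (hlim : HasPointwiseScalingLimit (criticalCorr 3) ρ S) (hnd : IsNondegenerateTwoPoint S) :
    ∃ (Δ' : ℝ) (S' : CorrFamily 3), Δ' ∈ Set.Icc (1 / 2 : ℝ) 1 ∧
      HasPointwiseScalingLimit (criticalCorr 3) ρ S' ∧ IsNondegenerateTwoPoint S' ∧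
        IsScaleCovariant Δ' S' ∧ ∀ n, Set.EqOn (S' n) (S n) (NonCoincident 3 n) := by
  obtain ⟨Δ', hwin, hsc'⟩ := exists_scaleCovariant_normalised hρ hlim hnd
  exact ⟨Δ', _, hwin, normalised_hasLimit hlim, normalised_nondeg hnd, hsc',
    fun n x hx => by simp only [if_pos hx]⟩

end Summit.CriticalPhenomena.Ising3DConformalLimit.MoebiusLimitExistsNegative

end
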